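import Summits.QuantumFields.YangMills.Theorems.BalabanUVNodesPortU8LDressResponse

/-!
# PORT helper (PT-H ∕ K0ᴬ JOIN lineage `ymgap-nodeO-port-PTC-1`, g3; ORDER O-7 TREE HALF) — receipt (E1′) `IotaRowAtL` PROVED: CHART-GENERICALLY (any (1.10)-dressed
# pair read by `sl2Coord ∘ mlog` ⊕ `sl2Coord`) and INSTANTIATED at DEF-1's dressed chart `recordEmbL F θ k K`

AUTHORSHIP ∕ CREDIT.  The mathematics and the Lean text of this file are ◇ LENS-1's (planner seat `ymgap-nodeO-lens-1` g5, HOME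
`pub/ym-nodeO-ideate/nodeO-cover/LENS-1-IotaRowAtL-v1.lean`, sha16 e5f7ba9f4793bf96, 230 l., 16 thm, 0 def; farm rc 0 · 0 sorry), landed VERBATIM by porter PTC-1 g3 under
port-lead ORDER O-7 («tree half = ▶ PTC-1, `--supports stmt-QuantumFields-27238 --as helper`»; nodeO STATUS 2026-08-31T02:14:10Z ∕ 02:23:59Z); only the namespace
(`…Theorems.PortHRecordJoin`, shared with the record JOIN files of ORDER O-3 (b)) and this header differ from the HOME bytes.
(E1′) = DEF-1 ed.14b's `K0RecordFormatNames.IotaRowAtL F θ k K` := `ContDiffAt ℝ 2 (recordEmbL F θ k K) 0 ∧ recordEmbL F θ k K 0 = 0` — the one porter receipt the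
JOIN of record (HOME `nodeO-cover/LENS-1-Slot8RecordJoin-v5.2.lean` 01e44366c253a20c) consumed as a hypothesis before its §19; the tree JOIN (`…PortHRecordJoin.lean`) cites
`iotaRowAtL_of_tokP9reg` below BY NAME.  [I] = [Balaban1987RG1], [15] = [Balaban1985Variational].
CONSUMED BY NAME, nothing re-declared: DEF-1's `recordPhi ∕ recordDress ∕ recordPairJ ∕ recordPairL ∕ recordEmbL ∕ recordBgField ∕ recordBgUnits ∕ recordCurrent ∕ sl2Coord ∕
sl2Proj ∕ chartEquivJ ∕ IotaRowAtL ∕ thetaFill` and `Sect2.cAct ∕ CPair` (Literature Node00), ★ PTB-1's `recordPhi_add ∕ recordPhi_smul` (✓p801893), `contDiff_sl2Coord ∕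
contDiff_star' ∕ contDiffAt_current ∕ coe_recordBgUnits_inv ∕ contDiffAt_matrix_of_entries_analyticAt` (IotaC2Transport), `recordBgField_zero ∕ recordEmbJ_zero ∕ sl2Coord_zero`
(IotaRow), DEF-1's `recordPairL_zero ∕ recordEmbL_zero_eq` (Lemmas10), port-M's `MatrixLog.analyticAt_mlog ∕ mlog_one`, Mathlib's `NormedSpace.exp_analytic`,
`LinearMap.toContinuousLinearMap` (finite dimensions: `Vβ` has the basis `bV`).

WHAT THIS FILE PROVES (theorems only; no `def ∕ instance ∕ notation ∕ sorry`; standard axioms).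
* §1 GENERIC (any parameter space `E`, base point `e₀`, any `P : Params`): `contDiff_mexp` (the matrix exponential on `M₂(ℂ)` is real-`C^∞`), `contDiffAt_mexp_comp ∕ _neg_comp`
  (`e ↦ exp (±φ e)` is `Cⁿ` when `φ` is — the mould's «exp ∘ (ℝ-linear)» layer, stated for any `Cⁿ` potential); `contDiffAt_cAct_fst ∕ _snd` (the (1.10)-dressed bond variables
  `u(b₋) 𝐔(b) u(b₊)⁻¹` and dressed currents `u(b₋) 𝐉(b) u(b₋)⁻¹` are `Cⁿ` when `u`, `u⁻¹`, `𝐔`, `𝐉` are); ★★ `contDiffAt_dressedChart` ∕ `contDiffAt_dressedChart_reindex` — the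
  two-block coordinates `(sl2Coord (log 𝐔ᵘ(b)), sl2Coord 𝐉ᵘ(b))_b` of the dressed pair `cAct (u e) (p e)` are `Cⁿ` at `e₀` provided `‖𝐔ᵘ(b)|_{e₀} − 1‖ < 1` (disc of the series
  logarithm), for ANY index map `σ`; `dressedChart_eq_zero` — they VANISH at a point where `u = 1`, `𝐔 = 1`, `𝐉 = 0`.
* §2 THE RECORD's DRESSED CHART: `contDiff_recordPhi` (`B ↦ φ_B(x)` is `C^∞`: ℝ-linear on a finite-dimensional space), `contDiff_recordDress_coe ∕ _inv_coe`, `recordPairL_fst_zero`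
  (`𝐔_L(b)|_{B=0} = 1`, standing range, `0 < εbg`); ★★ `contDiffAt_recordEmbL_of` — `recordEmbL F θ k K` is `C²` at `0` IF the rooted-gauge background field `B ↦ U_{k+1}(W_B)` is
  (bondwise in `M₂(ℂ)`; [15] Prop. 9 AT THE RECORD — displayed as the one hypothesis, as in PTB-1's rooted twin `contDiffAt_recordEmbJ_of`); ★★ `iotaRowAtL_of` — (E1′) from it.
* §3 THE TEXTS' INSTANCE: ★★ `iotaRowAtL_of_tokP9reg` — at `θ := thetaFill F a₀ ε₂₉` (`εbg = a₀ > 0`), standing range, (E1′) follows from TokP9-reg in its verbatim ENTRYWISE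
  `AnalyticAt ℝ` shape (hypothesis [11] of 27930 ⁸ ∕ 27931 v9-L); ★★ `iotaRowAtL_forall_of_tokP9reg` — the JOIN's `IotaRowH` with TokP9-reg written out (= `Lens1Slot8RecordJoin.IotaRowH`
  of JOIN v5.1 by `Iff.rfl` on `P9RegAt`).
HONEST FRAMING.  Calculus bookkeeping on DEF-1's dressed chart; NOTHING of Bałaban's analysis ([15] Thm 1 ∕ Prop. 9 off the flat sector, (190), (5.10), (4.33)) is asserted, ported
or discharged; 27930 ∕ 27931 ∕ 26648 OPEN; K0⁷ ∕ K0ᴬ NOT closed; NODE O 0∕1; COUNT 8∕28 · K 1∕4 UNMOVED; finite `𝕋⁴_{L^K}` at fixed ε — NOT continuum ∕ OS ∕ Clay;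
**the Yang–Mills mass gap (Clay) is NOT proved by any of this.**
-/

noncomputable section

open scoped BigOperators Matrix.Norms.L2Operator

namespace Summit.QuantumFields.YangMills.Theorems.PortHRecordJoin

open Literature.MathematicalPhysics.QuantumFieldTheory.Balaban1983to89
open Literature.MathematicalPhysics.QuantumFieldTheory.Balaban1983to89.Node00
open Literature.MathematicalPhysics.QuantumFieldTheory.Balaban1983to89.T4Continuum (T4Family)
open Summit.QuantumFields.YangMills.Theorems.K0RecordFormatNames
open Summit.QuantumFields.YangMills.Theorems.PortU8
open NormedSpace (exp)

/-! ## §1  GENERIC: the two-block coordinates of a (1.10)-dressed pair are `Cⁿ` -/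

section Generic

variable {P : Params} {E : Type*} [NormedAddCommGroup E] [NormedSpace ℝ E] {n : WithTop ℕ∞} {e₀ : E}

/-- The matrix exponential on `M₂(ℂ)` is real-`C^∞` (it is real-analytic). [cite: Balaban1987RG1, (1.10) p.262 (bookkeeping)] -/
theorem contDiff_mexp : ContDiff ℝ n (fun A : MatA 2 => exp A) :=
  contDiff_iff_contDiffAt.2 fun X => ((NormedSpace.exp_analytic (𝕂 := ℂ) X).contDiffAt).restrict_scalars ℝ

/-- `e ↦ exp (φ e)` is `Cⁿ` at `e₀` when the potential `φ` is (the mould's «exp ∘ potential» layer). [cite: Balaban1987RG1, (1.10) p.262, (4.2) p.281 (bookkeeping)] -/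
theorem contDiffAt_mexp_comp {φ : E → MatA 2} (hφ : ContDiffAt ℝ n φ e₀) : ContDiffAt ℝ n (fun e => exp (φ e)) e₀ :=
  contDiff_mexp.contDiffAt.comp e₀ hφ

/-- `e ↦ exp (−φ e)` (the inverse dressing) is `Cⁿ` at `e₀` when `φ` is. [cite: Balaban1987RG1, (1.10) p.262, (4.2) p.281 (bookkeeping)] -/
theorem contDiffAt_mexp_neg_comp {φ : E → MatA 2} (hφ : ContDiffAt ℝ n φ e₀) : ContDiffAt ℝ n (fun e => exp (-φ e)) e₀ :=
  contDiff_mexp.contDiffAt.comp e₀ hφ.neg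

/-- **The (1.10)-dressed bond variable `u(b₋) 𝐔(b) u(b₊)⁻¹` is `Cⁿ`** when the dressing, its inverse and the bond variable are. [cite: Balaban1987RG1, (1.10) p.262] -/
theorem contDiffAt_cAct_fst {u : E → Site P 0 → (MatA 2)ˣ} {p : E → Sect2.CPair P (MatA 2)}
    (hu : ∀ x, ContDiffAt ℝ n (fun e => (u e x : MatA 2)) e₀) (hu' : ∀ x, ContDiffAt ℝ n (fun e => (((u e x)⁻¹ : (MatA 2)ˣ) : MatA 2)) e₀)
    (hp₁ : ∀ b, ContDiffAt ℝ n (fun e => (p e).1 b) e₀) (b : PBond P 0) :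
    ContDiffAt ℝ n (fun e => (Sect2.cAct (u e) (p e)).1 b) e₀ :=
  ((hu b.src).mul (hp₁ b)).mul (hu' b.tgt)

/-- **The (1.10)-dressed current `u(b₋) 𝐉(b) u(b₋)⁻¹` is `Cⁿ`** when the dressing, its inverse and the current are. [cite: Balaban1987RG1, (1.10) p.262] -/
theorem contDiffAt_cAct_snd {u : E → Site P 0 → (MatA 2)ˣ} {p : E → Sect2.CPair P (MatA 2)}
    (hu : ∀ x, ContDiffAt ℝ n (fun e => (u e x : MatA 2)) e₀) (hu' : ∀ x, ContDiffAt ℝ n (fun e => (((u e x)⁻¹ : (MatA 2)ˣ) : MatA 2)) e₀)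
    (hp₂ : ∀ b, ContDiffAt ℝ n (fun e => (p e).2 b) e₀) (b : PBond P 0) :
    ContDiffAt ℝ n (fun e => (Sect2.cAct (u e) (p e)).2 b) e₀ :=
  ((hu b.src).mul (hp₂ b)).mul (hu' b.src)

/-- ★★ **THE DRESSED TWO-BLOCK CHART IS `Cⁿ`** (generic): for a `Cⁿ` dressing `u` with `Cⁿ` inverse and a `Cⁿ` pair `p = (𝐔, 𝐉)`, the coordinates
`(b, c) ↦ (sl2Coord (log 𝐔ᵘ(b)) c ∣ sl2Coord (𝐉ᵘ(b)) c)` of the dressed pair `(𝐔ᵘ, 𝐉ᵘ) = cAct (u e) (p e)` are `Cⁿ` at `e₀`, provided each dressed bond variable at `e₀`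
lies in the disc of the series logarithm. [cite: Balaban1987RG1, (1.8)–(1.10) pp.261–262, (4.2) p.281, (4.35) p.290; Balaban1985Variational, Prop. 9 p.309] -/
theorem contDiffAt_dressedChart {u : E → Site P 0 → (MatA 2)ˣ} {p : E → Sect2.CPair P (MatA 2)}
    (hu : ∀ x, ContDiffAt ℝ n (fun e => (u e x : MatA 2)) e₀) (hu' : ∀ x, ContDiffAt ℝ n (fun e => (((u e x)⁻¹ : (MatA 2)ˣ) : MatA 2)) e₀)
    (hp₁ : ∀ b, ContDiffAt ℝ n (fun e => (p e).1 b) e₀) (hp₂ : ∀ b, ContDiffAt ℝ n (fun e => (p e).2 b) e₀)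
    (h1 : ∀ b, ‖(Sect2.cAct (u e₀) (p e₀)).1 b - 1‖ < 1) :
    ContDiffAt ℝ n (fun e => fun bt : PBond P 0 × (Fin 3 ⊕ Fin 3) =>
      Sum.elim (fun a => sl2Coord (MatrixLog.mlog ((Sect2.cAct (u e) (p e)).1 bt.1)) a) (fun a => sl2Coord ((Sect2.cAct (u e) (p e)).2 bt.1) a) bt.2) e₀ := by
  have hlog : ∀ b (a : Fin 3), ContDiffAt ℝ n (fun e => sl2Coord (MatrixLog.mlog ((Sect2.cAct (u e) (p e)).1 b)) a) e₀ := by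
    intro b a
    have hm : ContDiffAt ℝ n (MatrixLog.mlog : MatA 2 → MatA 2) ((Sect2.cAct (u e₀) (p e₀)).1 b) :=
      ((MatrixLog.analyticAt_mlog (h1 b)).contDiffAt).restrict_scalars ℝ
    exact ContDiffAt.comp (g := fun A : MatA 2 => sl2Coord A a) e₀ (contDiff_sl2Coord a).contDiffAt
      (ContDiffAt.comp (g := (MatrixLog.mlog : MatA 2 → MatA 2)) (f := fun e => (Sect2.cAct (u e) (p e)).1 b) e₀ hm (contDiffAt_cAct_fst hu hu' hp₁ b))
  have hcur : ∀ b (a : Fin 3), ContDiffAt ℝ n (fun e => sl2Coord ((Sect2.cAct (u e) (p e)).2 b) a) e₀ := fun b a =>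
    ContDiffAt.comp (g := fun A : MatA 2 => sl2Coord A a) e₀ (contDiff_sl2Coord a).contDiffAt (contDiffAt_cAct_snd hu hu' hp₂ b)
  rw [contDiffAt_pi]
  rintro ⟨b, a | a⟩
  · simpa using hlog b a
  · simpa using hcur b a

/-- The same chart read through ANY index map `σ` (e.g. `(chartEquivJ F K).symm`) is `Cⁿ`. [cite: Balaban1987RG1, (4.35) p.290 (bookkeeping)] -/
theorem contDiffAt_dressedChart_reindex {ι' : Type*} [Fintype ι'] (σ : ι' → PBond P 0 × (Fin 3 ⊕ Fin 3))
    {u : E → Site P 0 → (MatA 2)ˣ} {p : E → Sect2.CPair P (MatA 2)}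
    (hu : ∀ x, ContDiffAt ℝ n (fun e => (u e x : MatA 2)) e₀) (hu' : ∀ x, ContDiffAt ℝ n (fun e => (((u e x)⁻¹ : (MatA 2)ˣ) : MatA 2)) e₀)
    (hp₁ : ∀ b, ContDiffAt ℝ n (fun e => (p e).1 b) e₀) (hp₂ : ∀ b, ContDiffAt ℝ n (fun e => (p e).2 b) e₀)
    (h1 : ∀ b, ‖(Sect2.cAct (u e₀) (p e₀)).1 b - 1‖ < 1) :
    ContDiffAt ℝ n (fun e => fun i : ι' =>
      Sum.elim (fun a => sl2Coord (MatrixLog.mlog ((Sect2.cAct (u e) (p e)).1 (σ i).1)) a) (fun a => sl2Coord ((Sect2.cAct (u e) (p e)).2 (σ i).1) a) (σ i).2) e₀ :=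
  contDiffAt_pi.2 fun i => contDiffAt_pi.1 (contDiffAt_dressedChart hu hu' hp₁ hp₂ h1) (σ i)

/-- **The dressed chart VANISHES at a point where `u = 1`, `𝐔 = 1`, `𝐉 = 0`** (`log 1 = 0`; the identity and `0` have no traceless coordinates).
[cite: Balaban1987RG1, (1.8)–(1.10) pp.261–262, (4.35) p.290 (bookkeeping)] -/
theorem dressedChart_eq_zero {u : Site P 0 → (MatA 2)ˣ} {p : Sect2.CPair P (MatA 2)}
    (hu0 : ∀ x, u x = 1) (hp1 : ∀ b, p.1 b = 1) (hp2 : ∀ b, p.2 b = 0) (bt : PBond P 0 × (Fin 3 ⊕ Fin 3)) :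
    Sum.elim (fun a => sl2Coord (MatrixLog.mlog ((Sect2.cAct u p).1 bt.1)) a) (fun a => sl2Coord ((Sect2.cAct u p).2 bt.1) a) bt.2 = 0 := by
  obtain ⟨b, t⟩ := bt
  have h1 : (Sect2.cAct u p).1 b = 1 := by simp [Sect2.cAct, hu0, hp1]
  have h2 : (Sect2.cAct u p).2 b = 0 := by simp [Sect2.cAct, hu0, hp2]
  rcases t with a | a
  · simp [h1, MatrixLog.mlog_one, sl2Coord_zero]
  · simp [h2, sl2Coord_zero]

end Generic

/-! ## §2  THE RECORD: the dressing `u_B = exp φ_B` is `C^∞` in `B`; the dressed chart `recordEmbL` is `C²` at `0` if `B ↦ U_{k+1}(W_B)` is; receipt (E1′) -/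

variable (F : T4Family) (θ : Stage13Params F 2)

/-- **`B ↦ φ_B(x)` is `C^∞`** — an ℝ-linear map (`recordPhi_add ∕ _smul`, ★ PTB-1) on a finite-dimensional space, hence a continuous linear map.
[cite: Balaban1985Variational, (21) p.281; Balaban1984PropagatorsII, (2.12) p.225 (bookkeeping)] -/
theorem contDiff_recordPhi {n : WithTop ℕ∞} (k K : ℕ) (x : Site (F.P K) 0) :
    letI := θ.instVβ₁; letI := θ.instVβ₂
    ContDiff ℝ n (fun B : Fin (F.P K).d → Site (F.P K) (k + 1) → θ.Vβ => recordPhi F θ k K B x) := by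
  letI := θ.instVβ₁; letI := θ.instVβ₂; letI := θ.instιβ
  haveI : FiniteDimensional ℝ θ.Vβ := Module.Finite.of_basis θ.bV
  let ΦL : (Fin (F.P K).d → Site (F.P K) (k + 1) → θ.Vβ) →ₗ[ℝ] MatA 2 :=
    { toFun := fun B => recordPhi F θ k K B x
      map_add' := fun B B' => recordPhi_add F θ k K B B' x
      map_smul' := fun t B => recordPhi_smul F θ k K t B x }
  exact (LinearMap.toContinuousLinearMap ΦL).contDiff

/-- **The dressing `u_B(x) = exp φ_B(x)` is `C^∞` in `B`.** [cite: Balaban1987RG1, (1.10) p.262, (4.2) p.281 (bookkeeping)] -/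
theorem contDiff_recordDress_coe {n : WithTop ℕ∞} (k K : ℕ) (x : Site (F.P K) 0) :
    letI := θ.instVβ₁; letI := θ.instVβ₂
    ContDiff ℝ n (fun B : Fin (F.P K).d → Site (F.P K) (k + 1) → θ.Vβ => (((recordDress F θ k K B).1 x : (MatA 2)ˣ) : MatA 2)) := by
  letI := θ.instVβ₁; letI := θ.instVβ₂
  show ContDiff ℝ n (fun B : Fin (F.P K).d → Site (F.P K) (k + 1) → θ.Vβ => exp (recordPhi F θ k K B x))
  exact contDiff_mexp.comp (contDiff_recordPhi F θ k K x)

/-- **Its inverse `u_B(x)⁻¹ = exp (−φ_B(x))` is `C^∞` in `B`.** [cite: Balaban1987RG1, (1.10) p.262, (4.2) p.281 (bookkeeping)] -/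
theorem contDiff_recordDress_inv_coe {n : WithTop ℕ∞} (k K : ℕ) (x : Site (F.P K) 0) :
    letI := θ.instVβ₁; letI := θ.instVβ₂
    ContDiff ℝ n (fun B : Fin (F.P K).d → Site (F.P K) (k + 1) → θ.Vβ => ((((recordDress F θ k K B).1 x)⁻¹ : (MatA 2)ˣ) : MatA 2)) := by
  letI := θ.instVβ₁; letI := θ.instVβ₂
  show ContDiff ℝ n (fun B : Fin (F.P K).d → Site (F.P K) (k + 1) → θ.Vβ => exp (-recordPhi F θ k K B x))
  exact contDiff_mexp.comp (contDiff_recordPhi F θ k K x).neg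

/-- **`𝐔_L(b)|_{B=0} = U_{k+1}(W_0)(b) = 1`** (standing range `k + 1 ≤ m + K`, `0 < θ.εbg`): at `B = 0` the dressing is the identity (`recordPairL_zero`) and the rooted background
field is the unit field (`recordBgField_zero`). [cite: Balaban1987RG1, (4.2) p.281, (0.21) p.256, (2.3) p.265] -/
theorem recordPairL_fst_zero (k K : ℕ) (hk : k + 1 ≤ (F.P K).m + (F.P K).K) (hε : 0 < θ.εbg) (b : PBond (F.P K) 0) :
    (letI := θ.instVβ₁; letI := θ.instVβ₂; (recordPairL F θ k K 0).1 b) = 1 := by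
  letI := θ.instVβ₁; letI := θ.instVβ₂
  rw [recordPairL_zero]
  show ((recordBgField F θ k K 0 b : SU 2) : MatA 2) = 1
  rw [recordBgField_zero F θ k K hk hε]; rfl

/-- ★★ **TRANSPORT OF `C²` TO THE DRESSED CHART** (instance of `contDiffAt_dressedChart_reindex` with `u := u_B`, `p := recordPairJ B`, `σ := (chartEquivJ F K).symm`): if
`B ↦ U_{k+1}(W_B)` (bondwise in `M₂(ℂ)`) is `C²` at `B = 0`, then `recordEmbL F θ k K` is `C²` at `0`. [cite: Balaban1987RG1, (4.2) p.281, (4.35) p.290, (1.8)–(1.10) pp.261–262;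
Balaban1985Variational, Prop. 9 p.309, (21) p.281] -/
theorem contDiffAt_recordEmbL_of (k K : ℕ) (hk : k + 1 ≤ (F.P K).m + (F.P K).K) (hε : 0 < θ.εbg)
    (hU : letI := θ.instVβ₁; letI := θ.instVβ₂;
      ContDiffAt ℝ 2 (fun B : Fin (F.P K).d → Site (F.P K) (k + 1) → θ.Vβ => fun b : PBond (F.P K) 0 => ((recordBgField F θ k K B b : SU 2) : MatA 2)) 0) :
    letI := θ.instVβ₁; letI := θ.instVβ₂; ContDiffAt ℝ 2 (recordEmbL F θ k K) 0 := by
  letI := θ.instVβ₁; letI := θ.instVβ₂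
  have hb : ∀ b, ContDiffAt ℝ 2 (fun B : Fin (F.P K).d → Site (F.P K) (k + 1) → θ.Vβ => ((recordBgField F θ k K B b : SU 2) : MatA 2)) 0 :=
    fun b => contDiffAt_pi.1 hU b
  have hW : ∀ b, ContDiffAt ℝ 2 (fun B : Fin (F.P K).d → Site (F.P K) (k + 1) → θ.Vβ => ((recordBgUnits F θ k K B b : (MatA 2)ˣ) : MatA 2)) 0 := hb
  have hW' : ∀ b, ContDiffAt ℝ 2 (fun B : Fin (F.P K).d → Site (F.P K) (k + 1) → θ.Vβ => (((recordBgUnits F θ k K B b)⁻¹ : (MatA 2)ˣ) : MatA 2)) 0 := by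
    intro b
    simp only [coe_recordBgUnits_inv]
    exact contDiff_star'.contDiffAt.comp 0 (hb b)
  have h1 : ∀ b, ‖(Sect2.cAct (fun x => ((recordDress F θ k K 0).1 x : (MatA 2)ˣ)) (recordPairJ F θ k K 0)).1 b - 1‖ < 1 := by
    intro b
    show ‖(recordPairL F θ k K 0).1 b - 1‖ < 1
    rw [recordPairL_fst_zero F θ k K hk hε b]; simp
  exact contDiffAt_dressedChart_reindex (fun i => (chartEquivJ F K).symm i)
    (u := fun (B : Fin (F.P K).d → Site (F.P K) (k + 1) → θ.Vβ) x => ((recordDress F θ k K B).1 x : (MatA 2)ˣ)) (p := recordPairJ F θ k K)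
    (fun x => (contDiff_recordDress_coe F θ k K x).contDiffAt) (fun x => (contDiff_recordDress_inv_coe F θ k K x).contDiffAt)
    hb (fun b => contDiffAt_current hW hW' sl2Proj ((F.P K).eta (k + 1)) b) h1

/-- ★★ **RECEIPT (E1′) `IotaRowAtL`** from the `C²` hypothesis: `C²` half = `contDiffAt_recordEmbL_of`; value half = `recordEmbL_zero_eq` (Lemmas10) + ★ PTB-1's (C2b)
`recordEmbJ_zero`. [cite: Balaban1987RG1, (4.35) p.290; Balaban1985Variational, Prop. 9 p.309] -/
theorem iotaRowAtL_of (k K : ℕ) (hk : k + 1 ≤ (F.P K).m + (F.P K).K) (hε : 0 < θ.εbg)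
    (hU : letI := θ.instVβ₁; letI := θ.instVβ₂;
      ContDiffAt ℝ 2 (fun B : Fin (F.P K).d → Site (F.P K) (k + 1) → θ.Vβ => fun b : PBond (F.P K) 0 => ((recordBgField F θ k K B b : SU 2) : MatA 2)) 0) :
    IotaRowAtL F θ k K := by
  letI := θ.instVβ₁; letI := θ.instVβ₂
  refine ⟨contDiffAt_recordEmbL_of F θ k K hk hε hU, ?_⟩
  rw [recordEmbL_zero_eq]
  exact recordEmbJ_zero F θ k K hk hε

/-! ## §3  THE TEXTS' INSTANCE: (E1′) from TokP9-reg (entrywise `AnalyticAt ℝ`) at `θ := thetaFill F a₀ ε₂₉` -/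

/-- ★★ **(E1′) FROM THE TEXTS' OWN ANTECEDENT TokP9-reg** (27931 v9-L ∕ 27930 ⁸, hypothesis [11], verbatim ENTRYWISE shape) at `θ := thetaFill F a₀ ε₂₉` (`εbg = a₀ > 0`), any
volume `K` in the standing range `k + 1 ≤ m + K`. [cite: Balaban1985Variational, Prop. 9 p.309; Balaban1987RG1, (4.35) p.290] -/
theorem iotaRowAtL_of_tokP9reg (a₀ ε₂₉ : ℝ) (ha₀ : 0 < a₀) (k K : ℕ) (hk : k + 1 ≤ (F.P K).m + (F.P K).K)
    (hreg : letI θ := thetaFill F a₀ ε₂₉; letI := θ.instVβ₁; letI := θ.instVβ₂;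
      AnalyticAt ℝ (fun B : Fin (F.P K).d → Site (F.P K) (k + 1) → θ.Vβ =>
        fun (b : PBond (F.P K) 0) (i i' : Fin 2) => ((recordBgField F θ k K B b : SU 2) : Matrix (Fin 2) (Fin 2) ℂ) i i') 0) :
    IotaRowAtL F (thetaFill F a₀ ε₂₉) k K := by
  letI := (thetaFill F a₀ ε₂₉).instVβ₁; letI := (thetaFill F a₀ ε₂₉).instVβ₂
  exact iotaRowAtL_of F (thetaFill F a₀ ε₂₉) k K hk ha₀
    (contDiffAt_matrix_of_entries_analyticAt
      (f := fun (B : Fin (F.P K).d → Site (F.P K) (k + 1) → (thetaFill F a₀ ε₂₉).Vβ) (b : PBond (F.P K) 0) =>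
        ((recordBgField F (thetaFill F a₀ ε₂₉) k K B b : SU 2) : MatA 2)) hreg)

/-- ★★ **THE JOIN's `IotaRowH`, WRITTEN OUT** (JOIN v5.1 `Lens1Slot8RecordJoin.IotaRowH` with `P9RegAt` unfolded — the same Prop by `Iff.rfl`): for every family, every
`a₀ > 0`, `ε₂₉ > 0`, every `(k, K)` in the standing range, TokP9-reg ⟹ (E1′). [cite: Balaban1985Variational, Prop. 9 p.309; Balaban1987RG1, (4.35) p.290] -/
theorem iotaRowAtL_forall_of_tokP9reg :
    ∀ (F : T4Family) (a₀ ε₂₉ : ℝ), 0 < a₀ → 0 < ε₂₉ → ∀ (k K : ℕ), k + 1 ≤ (F.P K).m + (F.P K).K →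
      (letI θ := thetaFill F a₀ ε₂₉; letI := θ.instVβ₁; letI := θ.instVβ₂;
        AnalyticAt ℝ (fun B : Fin (F.P K).d → Site (F.P K) (k + 1) → θ.Vβ =>
          fun (b : PBond (F.P K) 0) (i i' : Fin 2) => ((recordBgField F θ k K B b : SU 2) : Matrix (Fin 2) (Fin 2) ℂ) i i') 0) →
      IotaRowAtL F (thetaFill F a₀ ε₂₉) k K :=
  fun F a₀ ε₂₉ ha₀ _ k K hk hreg => iotaRowAtL_of_tokP9reg F a₀ ε₂₉ ha₀ k K hk hreg

end Summit.QuantumFields.YangMills.Theorems.PortHRecordJoin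

end
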